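/-
Copyright (c) 2026 the pub-hodgecm-mathlib formalisation cell (harness21).  Prover seat hodgecm-mathlib-K2E3-p32 (g0), HCML Track B «K2-LIT» (close-out strike line L4
`stub_StCharTS`), h413 = `stmt-HodgeConjecture-24833`, line `K2_E3_EllipticInputs`, unit U4 «Keys», PART «U4Keys» socket :155 (U4f-χ₁-ram-one-d0B)
`sig_K2E3KeysThmTwoContractingRamifiedCharOneDepthZeroNormTrivial` (LINE-LEAD K2E3-plan (g4) EMIT #5 2026-09-04T15:31:56Z, deal D162, cell «U4-RAM»; plan of record K2E3-p06 (g4)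
`PAPER-Z3-DepthZeroInert` ∕ `DESIGN-M2-v2-DepthZero`, step Z5 «assembly»): THE CONVERSION OF `Y = −1∕q` INTO KEYS' CASE (b)–(d) AT AN INERT PLACE IN BRANCH B.  2026-09-04.
-/
import Summits.HodgeConjecture.HodgeConjecture.Theorems.K2E3UnramifiedSignCharQuadratic              -- ★ (K2E3-p05 (g3)) `exists_conj_mul_self_eq_of_mem_unitsIntegers` (σ-fixed units are norms, unramified `v`); brings ★ `exists_uniformizer_zpow_mul`, ★ the σ-fixed uniformiser `ι_v ϖ_v` kit, ★ `valued_conjLocal_apply_of_smul_eq`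
import Summits.HodgeConjecture.HodgeConjecture.Theorems.K2E3UnramifiedCharacterValueAtUniformizer  -- ★ (K2E3-p05) `halfModulusChar_eq_one_of_mem_unitsIntegers`; brings ★ `continuous_halfModulusChar_apply`
import HarnessLib

/-!
# K2 ∕ E3 «EllipticInputs», unit U4 «Keys», leaf (U4f-χ₁-ram-one-d0B) — step Z5 «CONVERSION»: at an INERT place, BRANCH B (`χ₁(u·σu) = 1` on units) and
# `χ₁(ϖ) = −‖ϖ‖_E^{1∕2}` (the root `Y = −1∕q` of the Casselman-pair determinant) give `χ₁ = η‖·‖_E^{1∕2}` with `η|_{F^×} = ω_{E∕F}` — Keys §7 Thm (2) (b)–(d)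

Cell `pub/hodgecm-mathlib`, crux H413 = `stmt-HodgeConjecture-24833`, route of record `HCCMUnconditional`; chair K2-lead (g2), LINE-LEAD∕dealer K2E3-plan (g4), architect
K2E3-p25 (g3); cell «U4-RAM» (this seat on :155, K2E3-p37 on :182).  THEOREMS ONLY (no `def`, no `instance`, no `notation`, no named-fact hypothesis, no `sorry`); lane
`--supports stmt-HodgeConjecture-24833 --as helper`, count-neutral; the socket :155 stays OPEN (this is the last ALGEBRAIC step of the plan, not its analytic core).

THE MATHEMATICS (plan `PAPER-Z3-DepthZeroInert` §2, K2E3-p06 (g4), r01-screened).  `v` a place of `L⁺` non-split (`hns`) and UNRAMIFIED (`hunr`) in the CM field `L`, `E_v = Π_{w∣v} L_w`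
(one factor), `σ = c ⊗ 1` (★ `conjLocal`), `ϖ := ι_v(ϖ_v)` the `σ`-FIXED uniformiser unit (★ `isUnit_toLocalRing_uniformizer`, `conjLocal_toLocalRing_uniformizer`, `|ϖ_w| = exp(−1)` ★
`valued_toLocalRing_uniformizer_apply`).  In BRANCH B of the depth-zero leaf (`hB`: `χ₁(u·σu) = 1` for every unit `u` with `|u_w| = 1`) the `2 × 2` Casselman-pair determinant on the
Iwahori-character plane vanishes iff `Y := χ₁(ϖ) = −1∕q` (★ `K2E3BranchBDeterminantRoots.det_eq_zero_iff_of_norm_lt_one`), and `‖ϖ‖_E^{1∕2} = (q²)^{−1∕2} = q⁻¹` (★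
`unitModulusChar_toLocalRing_uniformizer`), i.e. `χ₁(ϖ) = −‖ϖ‖_E^{1∕2}`.  THIS FILE turns that value into the leaf's second disjunct:
put `η := χ₁ · (‖·‖_E^{1∕2})⁻¹`; then `η(ϖ) = −1`; on a `σ`-FIXED unit-integer `x`, `x = σ(z)·z` with `z` a unit (★ `exists_conj_mul_self_eq_of_mem_unitsIntegers` — units are norms at an
unramified place), `|z_w|² = |x_w| = 1` so `|z_w| = 1`, hence `χ₁(x) = χ₁(z·σz) = 1` (`hB`) and `‖x‖^{1∕2} = 1` (★), so `η(x) = 1`; and a character `η` with `η = 1` on the `σ`-fixed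
unit-integers and `η(ϖ) = −1` is `ω_{E∕F}` on `F_v^×` (§1: every `σ`-fixed unit is `x = ϖⁿu` with `u` a `σ`-fixed unit-integer ★ `exists_uniformizer_zpow_mul`, so `η(x) = (−1)ⁿ`, and `x` is a
norm iff `n` is even — the ★ p05 argument `isQuadraticCharExtension_of_unramified_of_apply_uniformizer` with its hypothesis «`η = 1` on ALL units» WEAKENED to «on the `σ`-fixed units»,
which is all it uses).  Continuity of `η` is ★ `continuous_halfModulusChar_apply`; `χ₁ = η · ‖·‖^{1∕2}` is group algebra.
* §1 **`isQuadraticCharExtension_of_apply_fixed_units_of_apply_uniformizer`** — `η = 1` on `σ`-fixed unit-integers ∧ `η(ι_vϖ_v) = −1` ⟹ ★ `IsQuadraticCharExtension σ η` (unramified `v`).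
* §2 `v_eq_one_of_conj_mul_self_eq` (`σ(z)z = x`, `|x_w| = 1 ⟹ |z_w| = 1`); **`apply_eq_one_of_branchB_of_fixed`** (`hB` ⟹ `χ₁ = 1` on `σ`-fixed unit-integers);
  **`exists_eta_of_branchB_of_apply_uniformizer`** — `hB` ∧ `χ₁(ι_vϖ_v) = −halfModulusChar(ι_vϖ_v)` ⟹ `∃ η, IsQuadraticCharExtension σ η ∧ Continuous η ∧ χ₁ = η * halfModulusChar`
  (the leaf's second disjunct VERBATIM); **`exists_eta_of_branchB_of_apply_uniformizer_eq_neg_inv_absNorm`** — the same from `χ₁(ι_vϖ_v) = −(N𝔭_v)⁻¹ ∈ ℂ` (the `Y = −1∕q` currency of ★ Z4).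

HONEST LABEL.  HC_CM is proved only modulo the 7 printed citations (2 remaining named inputs: hLiu418 = `stmt-HodgeConjecture-24832`, h413 = `stmt-HodgeConjecture-24833`) until rung 0
closes; count-neutral helper; (U4f-χ₁-ram-one-d0B) stays OPEN: still untyped are the second type vector `f_w` + «reducible ⟹ det M = 0» (Z2-B), the cell functions (Z3-a), the shell
integrals `I_m` (Z3-c), the dyadic inert place (α) and the RAMIFIED places (β, paper check owed).

## References
* [Keys1984] D. Keys, *Principal series representations of special unitary groups over local fields*, Compositio Math. 51 (1984), §7 Theorem (2) (b)–(d) p. 126.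
* [Rogawski1990] J. D. Rogawski, *Automorphic Representations of Unitary Groups in Three Variables*, Ann. of Math. Stud. 123 (1990), §12.2 (2) p. 173; §4.8 p. 51 (`μ|_{F^×} = ω_{E∕F}`).
* [Serre1979] J.-P. Serre, *Local Fields*, GTM 67 (1979), Ch. V §2 Prop. 3 (`N(U_E) = U_F` for unramified `E∕F`), Ch. XIV §3 (`F^×∕N E^×`).
* [Casselman1980] W. Casselman, *The unramified principal series of p-adic groups I*, Compositio Math. 40 (1980), §3 (the Casselman pair).
-/

set_option autoImplicit false
-- the mandated namespace has the single-problem summit's repeated segment (`HodgeConjecture.HodgeConjecture`)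
set_option linter.dupNamespace false

noncomputable section

open NumberField IsDedekindDomain
open scoped NNReal WithZero
open Literature.NumberTheory Literature.NumberTheory.Automorphic Literature.NumberTheory.Automorphic.UnitaryGroup
open Literature.NumberTheory.Rogawski1990 Literature.NumberTheory.GaloisRepresentations

namespace Summit.HodgeConjecture.HodgeConjecture.Cruxes.H413.K2E3KeysThmTwoDepthZeroBranchBConversion

open Summit.HodgeConjecture.HodgeConjecture.Cruxes.H413

variable (L : Type) [Field L] [NumberField L] [IsCMField L] (v : HeightOneSpectrum (𝓞 ↥(maximalRealSubfield L)))

/-! ## §1 `η|_{F_v^×} = ω_{E_v∕F_v}` for `η` trivial on the `σ`-FIXED unit-integers with `η(ι_vϖ_v) = −1` -/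

/-- **A character of `E_vˣ` trivial on the `σ`-FIXED unit-integers and `= −1` at the `σ`-fixed uniformiser `ι_vϖ_v` is `ω_{E∕F}` on `F_v^×`** (★ `IsQuadraticCharExtension σ η`: on `σ`-fixed
units `η x = 1 ↔ x = σ(y)·y`), at a non-split place `v` unramified in `L`.  Both sides say «`ord(x)` is even»: `x = ϖⁿu` with `u` a unit-integer (★ `exists_uniformizer_zpow_mul`), `u` is
`σ`-fixed because `x` and `ϖ` are, so `η x = (−1)ⁿ`; (←) a norm has even `ord`; (→) `u = σ(z)z` (★ `exists_conj_mul_self_eq_of_mem_unitsIntegers`), `y := ϖ^k z`.  This is ★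
`K2E3UnramifiedSignCharQuadratic.isQuadraticCharExtension_of_unramified_of_apply_uniformizer` with its hypothesis «`η = 1` on ALL unit-integers» weakened to the `σ`-fixed ones (all that proof
uses) — the form BRANCH B of the depth-zero ramified leaf supplies. [cite: Serre1979, Ch. V §2 Prop. 3; Ch. XIV §3] [cite: Rogawski1990, §4.8 p. 51; §12.2 (2) p. 173] [cite: Keys1984, §7 Theorem (2) (c) p. 126] -/
theorem isQuadraticCharExtension_of_apply_fixed_units_of_apply_uniformizer (hns : ∀ w : PlacesOver L v, IsCMField.complexConj L • w.1 = w.1)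
    (hunr : Algebra.IsUnramifiedIn (𝓞 L) v.asIdeal) (η : (LocalRing L v)ˣ →* ℂˣ)
    (hη : ∀ u ∈ (Submonoid.pi Set.univ (fun w : PlacesOver L v => (w.1.adicCompletionIntegers L).toSubring.toSubmonoid)).units,
      conjLocal L (IsCMField.complexConj L) v (u : LocalRing L v) = u → η u = 1)
    (hηϖ : η (isUnit_toLocalRing_uniformizer L v).unit = -1) :
    IsQuadraticCharExtension (conjLocal L (IsCMField.complexConj L) v) η := by
  intro x hx
  obtain ⟨w⟩ : Nonempty (PlacesOver L v) := inferInstance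
  -- the `σ`-fixed uniformiser unit `ϖ = ι_v ϖ_v`
  obtain ⟨ϖ, hϖdef⟩ : ∃ ϖ : (LocalRing L v)ˣ, ϖ = (isUnit_toLocalRing_uniformizer L v).unit := ⟨_, rfl⟩
  have hϖ : ∀ w' : PlacesOver L v, Valued.v ((ϖ : LocalRing L v) w') = WithZero.exp (-1 : ℤ) := fun w' => by
    rw [hϖdef]; exact valued_toLocalRing_uniformizer_apply L v w' hunr
  have hσϖ : conjLocal L (IsCMField.complexConj L) v (ϖ : LocalRing L v) = ϖ := by rw [hϖdef]; exact conjLocal_toLocalRing_uniformizer L v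
  have hηϖ' : η ϖ = -1 := by rw [hϖdef]; exact hηϖ
  -- `x = ϖⁿ u`, and `u` is `σ`-fixed
  obtain ⟨n, u, hu, hxu, hvx⟩ := K2E3NonUnitaryCharacterDichotomy.exists_uniformizer_zpow_mul L v hns ϖ hϖ x
  have hσux : Units.map (conjLocal L (IsCMField.complexConj L) v : LocalRing L v →* LocalRing L v) x = x := Units.ext hx
  have hσuϖ : Units.map (conjLocal L (IsCMField.complexConj L) v : LocalRing L v →* LocalRing L v) ϖ = ϖ := Units.ext hσϖ
  have hσu : conjLocal L (IsCMField.complexConj L) v (u : LocalRing L v) = u := by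
    have hu' : u = (ϖ ^ n)⁻¹ * x := by rw [hxu, inv_mul_cancel_left]
    have h := congrArg (fun t : (LocalRing L v)ˣ => (t : LocalRing L v))
      (show Units.map (conjLocal L (IsCMField.complexConj L) v : LocalRing L v →* LocalRing L v) u = u by
        rw [hu', map_mul, map_inv, map_zpow, hσux, hσuϖ])
    rw [Units.coe_map, MonoidHom.coe_coe] at h
    exact h
  have hηx : η x = (-1) ^ n := by rw [hxu, map_mul, map_zpow, hηϖ', hη u hu hσu, mul_one]
  have hsq1 : ((-1 : ℂˣ)) ^ (2 : ℤ) = 1 := by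
    rw [zpow_two]; exact Units.ext (by simp)
  constructor
  · -- (→) `η x = 1`: `n` is even, and `x = σ(y) y` with `y = ϖ^k z`
    intro h1
    rw [hηx] at h1
    obtain ⟨k, hk | hk⟩ := Int.even_or_odd' n
    · obtain ⟨z, hz⟩ := K2E3UnramifiedSignCharQuadratic.exists_conj_mul_self_eq_of_mem_unitsIntegers L v hunr u hu hσu
      have hzu : Units.map (conjLocal L (IsCMField.complexConj L) v : LocalRing L v →* LocalRing L v) z * z = u :=
        Units.ext (by rw [Units.val_mul, Units.coe_map, MonoidHom.coe_coe]; exact hz)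
      refine ⟨ϖ ^ k * z, ?_⟩
      have key : Units.map (conjLocal L (IsCMField.complexConj L) v : LocalRing L v →* LocalRing L v) (ϖ ^ k * z) * (ϖ ^ k * z) = x := by
        rw [map_mul, map_zpow, hσuϖ, mul_assoc, mul_left_comm (Units.map _ z) (ϖ ^ k) z, ← mul_assoc, ← zpow_add, hzu, hxu, hk, two_mul]
      have h := congrArg (fun t : (LocalRing L v)ˣ => (t : LocalRing L v)) key
      rw [Units.val_mul, Units.coe_map, MonoidHom.coe_coe] at h
      exact h
    · -- `n` odd: `η x = −1 ≠ 1`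
      exfalso
      rw [hk, zpow_add, zpow_one, zpow_mul, hsq1, one_zpow, one_mul] at h1
      exact absurd (congrArg Units.val h1) (by norm_num)
  · -- (←) `x = σ(y) y`: `ord(x) = 2 ord(y)` is even
    rintro ⟨y, hy⟩
    obtain ⟨m, u', -, -, hvy⟩ := K2E3NonUnitaryCharacterDichotomy.exists_uniformizer_zpow_mul L v hns ϖ hϖ y
    have hval := congrArg (fun r : LocalRing L v => Valued.v (r w)) hy
    simp only [Pi.mul_apply, map_mul] at hval
    rw [valued_conjLocal_apply_of_smul_eq L v w (hns w) (y : LocalRing L v), hvy w, hvx w, ← WithZero.exp_add] at hval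
    have hnm : n = 2 * m := by
      have := WithZero.exp_injective hval
      omega
    rw [hηx, hnm, zpow_mul, hsq1, one_zpow]

/-! ## §2 Branch B: `χ₁ = 1` on the `σ`-fixed unit-integers; the conversion of `χ₁(ϖ) = −‖ϖ‖^{1∕2}` into Keys' (b)–(d) -/

/-- `σ(z)·z = x` with `|x_w| = 1` forces `|z_w| = 1` (`|σ(z)_w| = |z_w|` at a non-split place ★ `valued_conjLocal_apply_of_smul_eq`, and `t·t = 1 ⇒ t = 1` in the ordered value group).
[cite: Serre1979, Ch. V §2 Prop. 3] -/
theorem v_eq_one_of_conj_mul_self_eq (hns : ∀ w : PlacesOver L v, IsCMField.complexConj L • w.1 = w.1) {z x : (LocalRing L v)ˣ}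
    (hz : conjLocal L (IsCMField.complexConj L) v (z : LocalRing L v) * z = x) (hx : ∀ w : PlacesOver L v, Valued.v ((x : LocalRing L v) w) = 1)
    (w : PlacesOver L v) : Valued.v ((z : LocalRing L v) w) = 1 := by
  have hval := congrArg (fun r : LocalRing L v => Valued.v (r w)) hz
  simp only [Pi.mul_apply, map_mul] at hval
  rw [valued_conjLocal_apply_of_smul_eq L v w (hns w) (z : LocalRing L v), hx w] at hval
  -- `t · t = 1 ⇒ t = 1` in the linearly ordered value group
  rcases lt_trichotomy (Valued.v ((z : LocalRing L v) w)) 1 with hlt | heq | hgt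
  · exact absurd hval (mul_lt_one' hlt hlt).ne
  · exact heq
  · exact absurd hval (one_lt_mul'' hgt hgt).ne'

/-- **BRANCH B ⟹ `χ₁ = 1` ON THE `σ`-FIXED UNIT-INTEGERS** at an unramified non-split place: a `σ`-fixed unit-integer is `x = σ(z)·z` with `z` a unit (★ `exists_conj_mul_self_eq_of_mem_unitsIntegers`)
of absolute value `1` in every factor, and `χ₁(z · σz) = 1` is the Branch-B hypothesis `hB` of the leaf (`w₀ ∈ W_χ`: `χ₁ ∘ N_{E∕F} = 1` on units). [cite: Serre1979, Ch. V §2 Prop. 3]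
[cite: Keys1984, §7 Theorem (2) p. 126] -/
theorem apply_eq_one_of_branchB_of_fixed (hns : ∀ w : PlacesOver L v, IsCMField.complexConj L • w.1 = w.1) (hunr : Algebra.IsUnramifiedIn (𝓞 L) v.asIdeal)
    (χ₁ : (LocalRing L v)ˣ →* ℂˣ)
    (hB : ∀ u : (LocalRing L v)ˣ, (∀ w' : PlacesOver L v, Valued.v ((u : LocalRing L v) w') = 1) →
      χ₁ (u * Units.map (conjLocal L (IsCMField.complexConj L) v : LocalRing L v →* LocalRing L v) u) = 1)
    (x : (LocalRing L v)ˣ) (hx : x ∈ (Submonoid.pi Set.univ (fun w : PlacesOver L v => (w.1.adicCompletionIntegers L).toSubring.toSubmonoid)).units)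
    (hσx : conjLocal L (IsCMField.complexConj L) v (x : LocalRing L v) = x) : χ₁ x = 1 := by
  obtain ⟨z, hz⟩ := K2E3UnramifiedSignCharQuadratic.exists_conj_mul_self_eq_of_mem_unitsIntegers L v hunr x hx hσx
  have hx1 : ∀ w' : PlacesOver L v, Valued.v ((x : LocalRing L v) w') = 1 := (F0P3cStCharTSTorusCompactPart.mem_unitsIntegers_iff L v x).1 hx
  have hz1 : ∀ w' : PlacesOver L v, Valued.v ((z : LocalRing L v) w') = 1 := fun w' => v_eq_one_of_conj_mul_self_eq L v hns hz hx1 w'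
  have hxz : x = z * Units.map (conjLocal L (IsCMField.complexConj L) v : LocalRing L v →* LocalRing L v) z :=
    Units.ext (by rw [Units.val_mul, Units.coe_map, MonoidHom.coe_coe, mul_comm]; exact hz.symm)
  rw [hxz]
  exact hB z hz1

/-- **THE CONVERSION (Keys §7 Thm (2) (b)–(d) at an inert place, Branch B).**  `v` non-split and unramified in `L`, `χ₁` a continuous character of `E_vˣ` with the Branch-B hypothesis `hB`
(`χ₁(u·σu) = 1` on units) and `χ₁(ι_vϖ_v) = −‖ι_vϖ_v‖_E^{1∕2}` (the root `Y = −1∕q` of the Casselman-pair determinant, ★ `K2E3BranchBDeterminantRoots`).  Then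
`∃ η, IsQuadraticCharExtension σ η ∧ Continuous η ∧ χ₁ = η · halfModulusChar` — the second disjunct of the leaf (U4f-χ₁-ram-one-d0B) VERBATIM, with `η := χ₁ · (‖·‖^{1∕2})⁻¹`
(`η(ϖ) = −1`, `η = 1` on the `σ`-fixed unit-integers by `apply_eq_one_of_branchB_of_fixed` and ★ `halfModulusChar_eq_one_of_mem_unitsIntegers`, §1, ★ `continuous_halfModulusChar_apply`).
[cite: Keys1984, §7 Theorem (2) (b)–(d) p. 126] [cite: Rogawski1990, §12.2 (2) p. 173] [cite: Casselman1980, §3] -/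
theorem exists_eta_of_branchB_of_apply_uniformizer (hns : ∀ w : PlacesOver L v, IsCMField.complexConj L • w.1 = w.1) (hunr : Algebra.IsUnramifiedIn (𝓞 L) v.asIdeal)
    (χ₁ : (LocalRing L v)ˣ →* ℂˣ) (h₁ : Continuous (fun x => ((χ₁ x : ℂˣ) : ℂ)))
    (hB : ∀ u : (LocalRing L v)ˣ, (∀ w' : PlacesOver L v, Valued.v ((u : LocalRing L v) w') = 1) →
      χ₁ (u * Units.map (conjLocal L (IsCMField.complexConj L) v : LocalRing L v →* LocalRing L v) u) = 1)
    (hY : χ₁ (isUnit_toLocalRing_uniformizer L v).unit = -halfModulusChar (LocalRing L v) (isUnit_toLocalRing_uniformizer L v).unit) :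
    ∃ η : (LocalRing L v)ˣ →* ℂˣ, IsQuadraticCharExtension (conjLocal L (IsCMField.complexConj L) v) η ∧
      Continuous (fun x => ((η x : ℂˣ) : ℂ)) ∧ χ₁ = η * halfModulusChar (LocalRing L v) := by
  refine ⟨χ₁ * (halfModulusChar (LocalRing L v))⁻¹, ?_, ?_, ?_⟩
  · refine isQuadraticCharExtension_of_apply_fixed_units_of_apply_uniformizer L v hns hunr _ (fun u hu hσu => ?_) ?_
    · rw [MonoidHom.mul_apply, MonoidHom.inv_apply, apply_eq_one_of_branchB_of_fixed L v hns hunr χ₁ hB u hu hσu,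
        K2E3UnramifiedCharacterValueAtUniformizer.halfModulusChar_eq_one_of_mem_unitsIntegers L v u hu, inv_one, mul_one]
    · rw [MonoidHom.mul_apply, MonoidHom.inv_apply, hY, neg_mul, mul_inv_cancel]
  · have hcont : Continuous fun x : (LocalRing L v)ˣ => ((χ₁ x : ℂˣ) : ℂ) * (((halfModulusChar (LocalRing L v) x : ℂˣ) : ℂ))⁻¹ :=
      h₁.mul ((continuous_halfModulusChar_apply L v).inv₀ fun x => Units.ne_zero _)
    refine hcont.congr fun x => ?_
    rw [MonoidHom.mul_apply, MonoidHom.inv_apply, Units.val_mul, Units.val_inv_eq_inv_val]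
  · exact MonoidHom.ext fun x => by rw [MonoidHom.mul_apply, MonoidHom.mul_apply, MonoidHom.inv_apply, inv_mul_cancel_right]

/-- **The same in the `Y = −1∕q` currency of ★ Z4**: if `χ₁(ι_vϖ_v) = −(N𝔭_v)⁻¹` as a complex number (the admissible root of ★ `det_eq_zero_iff_of_norm_lt_one`, `q = N𝔭_v`), then the leaf's second
disjunct holds — because `‖ι_vϖ_v‖_E = (N𝔭_v)⁻²` at an inert place (★ `unitModulusChar_toLocalRing_uniformizer`), so `‖ι_vϖ_v‖_E^{1∕2} = (N𝔭_v)⁻¹`.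
[cite: Keys1984, §7 Theorem (2) (b)–(d) p. 126] [cite: Rogawski1990, §12.2 (2) p. 173] -/
theorem exists_eta_of_branchB_of_apply_uniformizer_eq_neg_inv_absNorm (hns : ∀ w : PlacesOver L v, IsCMField.complexConj L • w.1 = w.1)
    (hunr : Algebra.IsUnramifiedIn (𝓞 L) v.asIdeal)
    (χ₁ : (LocalRing L v)ˣ →* ℂˣ) (h₁ : Continuous (fun x => ((χ₁ x : ℂˣ) : ℂ)))
    (hB : ∀ u : (LocalRing L v)ˣ, (∀ w' : PlacesOver L v, Valued.v ((u : LocalRing L v) w') = 1) →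
      χ₁ (u * Units.map (conjLocal L (IsCMField.complexConj L) v : LocalRing L v →* LocalRing L v) u) = 1)
    (hY : ((χ₁ (isUnit_toLocalRing_uniformizer L v).unit : ℂˣ) : ℂ) = -((Ideal.absNorm v.asIdeal : ℂ))⁻¹) :
    ∃ η : (LocalRing L v)ˣ →* ℂˣ, IsQuadraticCharExtension (conjLocal L (IsCMField.complexConj L) v) η ∧
      Continuous (fun x => ((η x : ℂˣ) : ℂ)) ∧ χ₁ = η * halfModulusChar (LocalRing L v) := by
  obtain ⟨w⟩ : Nonempty (PlacesOver L v) := inferInstance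
  refine exists_eta_of_branchB_of_apply_uniformizer L v hns hunr χ₁ h₁ hB (Units.ext ?_)
  -- `‖ϖ‖^{1∕2} = ((q²)⁻¹)^{1∕2} = q⁻¹` as a complex number
  have hmod : unitModulusChar (LocalRing L v) (isUnit_toLocalRing_uniformizer L v).unit = ((Ideal.absNorm v.asIdeal : ℝ≥0) ^ 2)⁻¹ :=
    unitModulusChar_toLocalRing_uniformizer L v w (hns w) hunr
  have hsqrt : NNReal.sqrt (unitModulusChar (LocalRing L v) (isUnit_toLocalRing_uniformizer L v).unit) = ((Ideal.absNorm v.asIdeal : ℝ≥0))⁻¹ := by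
    rw [hmod, NNReal.sqrt_inv, NNReal.sqrt_sq]
  rw [hY, Units.val_neg, coe_halfModulusChar_apply, hsqrt, NNReal.coe_inv, NNReal.coe_natCast, Complex.ofReal_inv, Complex.ofReal_natCast]

end Summit.HodgeConjecture.HodgeConjecture.Cruxes.H413.K2E3KeysThmTwoDepthZeroBranchBConversion

end
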